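import Mathlib.RingTheory.Flat.Equalizer
import Mathlib.RingTheory.Flat.TorsionFree
import Mathlib.LinearAlgebra.TensorProduct.Pi
import Mathlib.LinearAlgebra.Matrix.ToLin
import Mathlib.LinearAlgebra.Basis.Defs
import Mathlib.LinearAlgebra.Dual.Defs
import HarnessLib

/-!
# Route `RamifiedHeegnerPair`, crux U₁ `LeafRankOneUpperAtThree` (stmt-BirchSwinnertonDyer-26022), line `partnerdescent` —
# partner kernel: FLAT BASE CHANGE OF KERNELS in coordinates — the `S`-solutions of an integral linear system are spanned by its `R`-solutions

HONEST FRAMING. Theorems only; helper file (`--supports stmt-BirchSwinnertonDyer-26022 --as helper`); pure linear algebra over Mathlib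
(`Module.Flat.ker_lTensor_eq` transported through `TensorProduct.piScalarRight`); no number theory, no named fact, no `sorry`; nothing booked;
BSD is proved for no curve. Lead prover bsd-line-rhp-p2 g63, 2026-08-31. Serves the base-change layer (α) of LEAD-G63-ASSEMBLY.md §4b.

WHY. Two hypotheses of the local run `LeafPartnerOrders.dvd_of_localRun` (‹…LeafPartnerOrdersLocalRun›, p811638) are `3`-ADIC versions of INTEGRAL
typed inputs: (C5′) «for a Hecke operator `s` and an integer `a` with `δ·s = a·P` on `Y`: `δ ∣ a`» must hold for `ℤ₃`-linear combinations `s` of Hecke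
operators and `a ∈ ℤ₃`, and the saturation of `Y` in `B` must survive `ℤ₃ ⊗`. Both are instances of ONE statement: for a matrix `C` over `R` and a
FLAT `R`-algebra `S` (e.g. `ℤ → ℤ_[3]`: torsion-free over a Dedekind domain, Mathlib instance), every `S`-solution `v` of `C v = 0` is an `S`-linear
combination of (the images of) `R`-solutions — `mem_span_image_of_map_mulVec_eq_zero`; consequently an `R`-linear functional `λ` whose values on the
`R`-solutions are divisible by `δ` has values divisible by `δ` on the `S`-solutions — `dvd_dotProduct_of_map_mulVec_eq_zero` (the shape of
hypothesis `hC5`: unknowns = coordinates of `s` in a `ℤ`-basis of `𝕋` together with `a`; equations = `δ·s·y_j = a·P·y_j` on a basis of `Y`;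
`λ` = the `a`-coordinate). Also `forall_exists_pairing_eq_comp_of_basis`: the exact-Eisenstein hypothesis `hEis` of the run for ALL functionals from
its instances on a basis of functionals (finitely many integral representability statements).
[cite: Matsumura1987, Thm. 7.4 (i) and Thm. 7.6 (flat base change preserves kernels)] [cite: BourbakiAlgebraI1989, Ch. II §2 no. 6]
-/

set_option linter.dupNamespace false
set_option autoImplicit false

noncomputable section

open scoped TensorProduct

namespace Summit.BirchSwinnertonDyer.BirchSwinnertonDyer.Theorems.LeafPartnerOrders

variable {R : Type*} [CommRing R] {S : Type*} [CommRing S] [Algebra R S] [Module.Flat R S]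
  {κ ρ : Type*} [Fintype κ] [DecidableEq κ] [Fintype ρ] [DecidableEq ρ]

omit [Module.Flat R S] in
/-- The coordinate isomorphism `S ⊗ R^κ ≅ S^κ` intertwines `1 ⊗ C` with `C` read over `S`. [folklore] -/
theorem piScalarRight_lTensor_mulVecLin (C : Matrix ρ κ R) (x : S ⊗[R] (κ → R)) :
    TensorProduct.piScalarRight R S S ρ (TensorProduct.AlgebraTensorModule.lTensor S S (Matrix.mulVecLin C) x) =
      (C.map (algebraMap R S)).mulVec (TensorProduct.piScalarRight R S S κ x) := by
  induction x using TensorProduct.induction_on with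
  | zero => simp
  | tmul s w =>
      rw [TensorProduct.AlgebraTensorModule.lTensor_tmul, TensorProduct.piScalarRight_apply,
        TensorProduct.piScalarRight_apply, TensorProduct.piScalarRightHom_tmul, TensorProduct.piScalarRightHom_tmul]
      ext j
      simp only [Matrix.mulVecLin_apply, Matrix.mulVec, dotProduct, Matrix.map_apply, Algebra.smul_def,
        Finset.sum_mul, map_sum, map_mul]
      refine Finset.sum_congr rfl fun i _ ↦ ?_
      ring
  | add x y hx hy => rw [map_add, map_add, hx, hy, map_add, Matrix.mulVec_add]

/-- **Flat base change of kernels, in coordinates.** For a matrix `C` over `R` and a flat `R`-algebra `S`, every `v ∈ S^κ` with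
`C·v = 0` (read over `S`) lies in the `S`-span of the images of the `R`-solutions `w ∈ R^κ`, `C·w = 0`. (`ker(S ⊗ C) = S ⊗ ker C` by flatness,
Mathlib `Module.Flat.ker_lTensor_eq`, transported through `S ⊗ R^κ ≅ S^κ`.) In the derivation `R = ℤ`, `S = ℤ_[3]`.
[cite: Matsumura1987, Thm. 7.4 (i) and Thm. 7.6] -/
theorem mem_span_image_of_map_mulVec_eq_zero (C : Matrix ρ κ R) (v : κ → S)
    (hv : (C.map (algebraMap R S)).mulVec v = 0) :
    v ∈ Submodule.span S ((fun w : κ → R ↦ fun i ↦ algebraMap R S (w i)) '' {w | C.mulVec w = 0}) := by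
  let f : (κ → R) →ₗ[R] (ρ → R) := Matrix.mulVecLin C
  let eκ := TensorProduct.piScalarRight R S S κ
  let eρ := TensorProduct.piScalarRight R S S ρ
  -- `x := eκ⁻¹ v` lies in the kernel of `1 ⊗ C`
  set x := eκ.symm v with hx
  have hker : x ∈ LinearMap.ker (TensorProduct.AlgebraTensorModule.lTensor S S f) := by
    rw [LinearMap.mem_ker, ← eρ.injective.eq_iff, map_zero, piScalarRight_lTensor_mulVecLin, hx,
      LinearEquiv.apply_symm_apply, hv]
  rw [Module.Flat.ker_lTensor_eq, LinearMap.mem_range] at hker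
  obtain ⟨z, hz⟩ := hker
  have hv' : v = eκ (TensorProduct.AlgebraTensorModule.lTensor S S (LinearMap.ker f).subtype z) := by
    rw [hz, hx, LinearEquiv.apply_symm_apply]
  rw [hv']
  clear hv' hz hx hv
  -- induction on `z ∈ S ⊗ ker C`
  induction z using TensorProduct.induction_on with
  | zero => rw [map_zero, map_zero]; exact Submodule.zero_mem _
  | tmul s w =>
      rw [TensorProduct.AlgebraTensorModule.lTensor_tmul, TensorProduct.piScalarRight_apply,
        TensorProduct.piScalarRightHom_tmul]
      have hw : (w : κ → R) ∈ {w : κ → R | C.mulVec w = 0} := by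
        have := w.2
        rw [LinearMap.mem_ker] at this
        exact this
      have heq : (fun j ↦ (LinearMap.ker f).subtype w j • s) = s • (fun i ↦ algebraMap R S ((w : κ → R) i)) := by
        ext j
        simp [Algebra.smul_def, mul_comm]
      rw [heq]
      exact Submodule.smul_mem _ s (Submodule.subset_span ⟨w, hw, rfl⟩)
  | add x y hx' hy' => rw [map_add, map_add]; exact Submodule.add_mem _ hx' hy'

/-- **Divisibility of a functional on the `S`-solutions from divisibility on the `R`-solutions.** If `λ ∈ R^κ` has `δ ∣ λ·w` for every
`R`-solution `w` of `C·w = 0`, then `δ ∣ λ·v` (in `S`) for every `S`-solution `v` of the same system (`S` flat over `R`). This is the shape of the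
hypothesis `hC5` of `dvd_of_localRun` obtained from the INTEGRAL (C5′) «`δ·s = a·P` on `Y` with `s ∈ 𝕋`, `a ∈ ℤ` ⟹ `δ ∣ a`»: unknowns = the
coordinates of `s` in a `ℤ`-basis of `𝕋` and `a`; `λ` = the `a`-coordinate. [cite: Matsumura1987, Thm. 7.6] -/
theorem dvd_dotProduct_of_map_mulVec_eq_zero (C : Matrix ρ κ R) (lam : κ → R) (δ : R)
    (hR : ∀ w : κ → R, C.mulVec w = 0 → δ ∣ lam ⬝ᵥ w) (v : κ → S) (hv : (C.map (algebraMap R S)).mulVec v = 0) :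
    algebraMap R S δ ∣ (fun i ↦ algebraMap R S (lam i)) ⬝ᵥ v := by
  have hmem := mem_span_image_of_map_mulVec_eq_zero C v hv
  clear hv
  -- the functional `v ↦ λ_S · v` is `S`-linear; divisibility is preserved along the span
  induction hmem using Submodule.span_induction with
  | mem u hu =>
      obtain ⟨w, hw, rfl⟩ := hu
      obtain ⟨c, hc⟩ := hR w hw
      refine ⟨algebraMap R S c, ?_⟩
      rw [← map_mul, ← hc, dotProduct, dotProduct, map_sum]
      simp only [map_mul]
  | zero => rw [dotProduct_zero]; exact dvd_zero _
  | add u u' _ _ hu hu' => rw [dotProduct_add]; exact dvd_add hu hu'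
  | smul a u _ hu => rw [dotProduct_smul, smul_eq_mul]; exact Dvd.dvd.mul_left hu a

section EisensteinOnBasis

variable {O : Type*} [CommRing O] {M : Type*} [AddCommGroup M] [Module O M] {ι : Type*} [Fintype ι]

/-- **Exact Eisenstein on a basis of functionals suffices.** If `M` has a finite `O`-basis `b` and for every coordinate functional `b.coord k`
there is `x_k ∈ M` with `β(x_k, y) = (b.coord k)(u y)` for all `y`, then for EVERY functional `φ` there is `x` with `β(x, y) = φ(u y)`
(`x = Σ φ(b_k)·x_k`). This is the hypothesis `hEis` of `dvd_of_localRun` from finitely many INTEGRAL representability statements: in the derivation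
the `x_k` are the integral vectors `(T_ℓ − ℓ − 1)·x_k^∨ ∈ B` (`x_k^∨ ∈ B^∨` dual to a `ℤ`-basis of `B`, exact Eisenstein p806900), read in
`B̂ = ℤ₃ ⊗ B` whose `ℤ₃`-basis is the same `ℤ`-basis. [cite: BourbakiAlgebraI1989, Ch. II §2 no. 6 (dual basis)] -/
theorem forall_exists_pairing_eq_comp_of_basis (b : Module.Basis ι O M) (β : M →ₗ[O] M →ₗ[O] O) (u : M →ₗ[O] M)
    (x : ι → M) (hx : ∀ (k : ι) (y : M), β (x k) y = b.coord k (u y)) (φ : Module.Dual O M) :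
    ∃ z : M, ∀ y : M, β z y = φ (u y) := by
  classical
  refine ⟨∑ k, φ (b k) • x k, fun y ↦ ?_⟩
  rw [map_sum, LinearMap.sum_apply]
  simp only [map_smul, LinearMap.smul_apply, smul_eq_mul, hx]
  -- `φ (u y) = Σ_k (b.coord k (u y)) • φ (b k)`
  conv_rhs => rw [← b.sum_repr (u y), map_sum]
  refine Finset.sum_congr rfl fun k _ ↦ ?_
  rw [map_smul, smul_eq_mul, mul_comm, Module.Basis.coord_apply]

end EisensteinOnBasis

end Summit.BirchSwinnertonDyer.BirchSwinnertonDyer.Theorems.LeafPartnerOrders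

end
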